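import Summits.PneNP.PneNP.Theorems.CliqueExtLowerBound.Negative.AnchoredThetaCounting
import Summits.PneNP.PneNP.Theorems.CliqueExtLowerBound.Negative.AnchoredThetaChildren
import Summits.PneNP.PneNP.Theorems.CliqueExtLowerBound.Negative.AnchoredThetaHelpers

/-!
# Exit (ii) of Jukna's criterion is absurd on the anchored cliques (anchored-theta refutation, part E1)

Part of the refutation of `stub_convReplaceable` (line `width-threshold-certificate-sparsity` of
crux stmt-PneNP-10682, `ConvexRankGates.CliqueExtLowerBound`) by the ANCHORED THETA GATE; the final
theorem is `stub_convReplaceable_false` in `ConvReplaceableFalse.lean`, whose module docstring has the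
overview. Witness: at `c = 3`, for every `a`, localities `r = 3, s = 4`, at every large `m = n + 2`, the
theta programme on the `n+1` non-anchor vertices with clique parameter `k-1` (`k = ⌈m^{1/4}⌉₊`), fed
with children `d_j = {{e₀, p_j}}`, `c_j = {{e₀, f(α,γ), f(β,γ)} : γ < h}`, is not replaceable by any
monotone circuit of size `m^a`: Jukna's criterion on the derived coordinates kills both exits.
-/

set_option linter.dupNamespace false

namespace Summit.PneNP.PneNP.Theorems.CliqueExtLowerBound.Negative

open Literature.Computability.Complexity Literature.Combinatorics.SimpleGraph Matrix Finset Filter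

noncomputable section

/-! ## E. The finite lower bound: the two exits of Jukna's criterion are absurd -/

section Finite

open Classical in
/-- **Exit (ii) is absurd** (positives): if `Ψ ≤ ⋁_{j∈I} x_j ∨ D` with `#I < s'` and `D` an exact
`r'`-DNF of `≤ Z (s'-1)^{r'}` monomials, then `Ψ` rejects all but
`(s'-1) C(n-1,k-3) + Z (s'-1)^{r'} C(n+1-w₀, k-1-w₀)` of the `C(n, k-2)` anchored cliques, while (V1)
lets it reject at most `ε C(n+2, k)` of them. -/
theorem casePos_absurd (n k w Imax Dmax : ℕ) (ε : ℝ) (hε : 0 ≤ ε) (hk3 : 3 ≤ k) (hkw : w + 1 ≤ k)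
    (Ψ : Circuit (Fin (nP (n + 1))))
    (hV1 : (#((posGraphs (n + 2) k).filter (fun x =>
        (thetaGate (n + 1) (k - 1)).2 (fun j => decide (EvalDNF (dd n j) x)) = true ∧
          Ψ.eval (fun j => decide (EvalDNF (dd n j) x)) = false)) : ℝ) ≤ ε * #(posGraphs (n + 2) k))
    (𝓓 : Finset (Finset (Fin (nP (n + 1))))) (I : Finset (Fin (nP (n + 1))))
    (hDw : ∀ P ∈ 𝓓, (w - 1).choose 2 < #P) (hDcard : #𝓓 ≤ Dmax) (hIcard : #I ≤ Imax)
    (hcase : ∀ v, Ψ.eval v = true → SatClause I v ∨ EvalDNF 𝓓 v)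
    (Hii : ε * ((n + 2).choose k : ℝ) + (Imax : ℝ) * ((n - 1).choose (k - 3) : ℝ) +
        (Dmax : ℝ) * ((n + 1 - w).choose (k - 1 - w) : ℝ) < (n.choose (k - 2) : ℝ)) : False := by
  have hq1 : 1 ≤ k - 1 := by omega
  -- the anchored k-sets
  set 𝒦 : Finset (Finset (Fin (n + 2))) := powersetCard k (univ : Finset (Fin (n + 2))) with h𝒦
  set 𝒜 : Finset (Finset (Fin (n + 2))) := 𝒦.filter (fun K => ({aA n, bB n} : Finset _) ⊆ K) with h𝒜
  have hpair : #({aA n, bB n} : Finset (Fin (n + 2))) = 2 := card_pair (aA_ne_bB n)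
  have hA_card : #𝒜 = n.choose (k - 2) := by
    rw [h𝒜, h𝒦, card_filter_supset _ _ (by rw [hpair]; omega), hpair]
    simp
  have haA : ∀ K ∈ 𝒜, aA n ∈ K := fun K hK => (mem_filter.1 hK).2 (mem_insert_self _ _)
  have hbB : ∀ K ∈ 𝒜, bB n ∈ K := fun K hK =>
    (mem_filter.1 hK).2 (mem_insert_of_mem (mem_singleton_self _))
  -- values on 𝒜
  have hu : ∀ K ∈ 𝒜, (fun j => decide (EvalDNF (dd n j) (cliqueVec K))) =
      fun j => cliqueVec (derS n K) ((eqv (n + 1)).symm j) := fun K hK =>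
    dval_eq_cliqueVec n (haA K hK) (hbB K hK)
  have hacc : ∀ K ∈ 𝒜,
      (thetaGate (n + 1) (k - 1)).2 (fun j => decide (EvalDNF (dd n j) (cliqueVec K))) = true := by
    intro K hK
    rw [hu K hK]
    have hKk : #K = k := (mem_powersetCard.1 (mem_filter.1 hK).1).2
    exact thetaGate_accepts (derS n K) (by rw [card_derS n (haA K hK), hKk]) hq1 _ le_rfl
  -- split 𝒜 by Ψ
  set 𝒜₀ := 𝒜.filter (fun K => Ψ.eval (fun j => decide (EvalDNF (dd n j) (cliqueVec K))) = false)
    with h𝒜₀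
  set 𝒜₁ := 𝒜.filter (fun K => ¬ Ψ.eval (fun j => decide (EvalDNF (dd n j) (cliqueVec K))) = false)
    with h𝒜₁
  have hsplit : #𝒜₀ + #𝒜₁ = #𝒜 := Finset.card_filter_add_card_filter_not _
  -- (1) 𝒜₀ is small by (V1)
  have h0 : (#𝒜₀ : ℝ) ≤ ε * (n + 2).choose k := by
    have hinj : Set.InjOn cliqueVec (𝒜₀ : Set (Finset (Fin (n + 2)))) := by
      intro K hK K' hK' hKK
      exact cliqueVec_inj_of_mem n (haA K (mem_filter.1 (mem_coe.1 hK)).1)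
        (haA K' (mem_filter.1 (mem_coe.1 hK')).1) hKK
    have hsub : 𝒜₀.image cliqueVec ⊆ (posGraphs (n + 2) k).filter (fun x =>
        (thetaGate (n + 1) (k - 1)).2 (fun j => decide (EvalDNF (dd n j) x)) = true ∧
          Ψ.eval (fun j => decide (EvalDNF (dd n j) x)) = false) := by
      intro x hx
      obtain ⟨K, hK, rfl⟩ := mem_image.1 hx
      rw [mem_filter] at hK ⊢
      exact ⟨mem_image_of_mem _ (mem_filter.1 hK.1).1, hacc K hK.1, hK.2⟩
    have hP : #(posGraphs (n + 2) k) ≤ (n + 2).choose k := by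
      calc #(posGraphs (n + 2) k) ≤ #𝒦 := card_image_le
        _ = (n + 2).choose k := by simp [h𝒦, card_powersetCard]
    calc (#𝒜₀ : ℝ) = #(𝒜₀.image cliqueVec) := by rw [card_image_of_injOn hinj]
      _ ≤ #((posGraphs (n + 2) k).filter (fun x =>
          (thetaGate (n + 1) (k - 1)).2 (fun j => decide (EvalDNF (dd n j) x)) = true ∧
            Ψ.eval (fun j => decide (EvalDNF (dd n j) x)) = false)) := by
          exact_mod_cast card_le_card hsub
      _ ≤ ε * #(posGraphs (n + 2) k) := hV1
      _ ≤ ε * (n + 2).choose k := by gcongr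
  -- (2) 𝒜₁ is covered by few superset-families
  let T : Fin (nP (n + 1)) → Finset (Fin (n + 2)) := fun j =>
    insert (aA n) ((verts n (pr n j)).map Fin.castSuccEmb)
  let S : Finset (Fin (nP (n + 1))) → Finset (Fin (n + 2)) := fun P =>
    insert (aA n) ((spanV n P).map Fin.castSuccEmb)
  have hcover : 𝒜₁ ⊆ (I.biUnion fun j => 𝒦.filter fun K => T j ⊆ K) ∪
      (𝓓.biUnion fun P => 𝒦.filter fun K => S P ⊆ K) := by
    intro K hK
    rw [mem_filter] at hK
    obtain ⟨hKA, hΨ⟩ := hK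
    have hΨ' : Ψ.eval (fun j => decide (EvalDNF (dd n j) (cliqueVec K))) = true := by
      simpa using hΨ
    have hK𝒦 : K ∈ 𝒦 := (mem_filter.1 hKA).1
    have hon : ∀ j, (fun j => decide (EvalDNF (dd n j) (cliqueVec K))) j = true →
        (verts n (pr n j)).map Fin.castSuccEmb ⊆ K := by
      intro j hj
      rw [hu K hKA] at hj
      intro v hv
      obtain ⟨α, hα, rfl⟩ := Finset.mem_map.1 hv
      simp only [cliqueVec, decide_eq_true_eq] at hj
      have := hj α ((mem_verts n).1 hα)
      exact (mem_filter.1 this).2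
    rcases hcase _ hΨ' with ⟨j, hjI, hj⟩ | ⟨P, hP𝓓, hP⟩
    · refine mem_union_left _ (mem_biUnion.2 ⟨j, hjI, mem_filter.2 ⟨hK𝒦, ?_⟩⟩)
      exact insert_subset (haA K hKA) (hon j hj)
    · refine mem_union_right _ (mem_biUnion.2 ⟨P, hP𝓓, mem_filter.2 ⟨hK𝒦, ?_⟩⟩)
      refine insert_subset (haA K hKA) ?_
      intro v hv
      obtain ⟨α, hα, rfl⟩ := Finset.mem_map.1 hv
      obtain ⟨j, hjP, hαj⟩ := mem_biUnion.1 hα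
      exact hon j (hP j hjP) (Finset.mem_map.2 ⟨α, hαj, rfl⟩)
  -- counts of the covering families
  have hT : ∀ j, #(𝒦.filter fun K => T j ⊆ K) = (n - 1).choose (k - 3) := by
    intro j
    have hTcard : #(T j) = 3 := by
      simp only [T]
      rw [card_insert_of_notMem, card_map, card_verts]
      intro h
      obtain ⟨α, -, hα⟩ := Finset.mem_map.1 h
      exact castSucc_ne_aA n α hα
    rw [h𝒦, card_filter_supset _ _ (by rw [hTcard]; omega), hTcard]
    simp
  have hS : ∀ P ∈ 𝓓, #(𝒦.filter fun K => S P ⊆ K) ≤ (n + 1 - w).choose (k - 1 - w) := by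
    intro P hP
    have hspan : w ≤ #(spanV n P) := le_card_spanV n P w (hDw P hP)
    obtain ⟨W, hWsub, hWcard⟩ := exists_subset_card_eq hspan
    have hS' : insert (aA n) (W.map Fin.castSuccEmb) ⊆ S P :=
      insert_subset_insert _ (map_subset_map.2 hWsub)
    have hcard' : #(insert (aA n) (W.map Fin.castSuccEmb)) = w + 1 := by
      rw [card_insert_of_notMem, card_map, hWcard]
      intro h
      obtain ⟨α, -, hα⟩ := Finset.mem_map.1 h
      exact castSucc_ne_aA n α hα
    calc #(𝒦.filter fun K => S P ⊆ K)
        ≤ #(𝒦.filter fun K => insert (aA n) (W.map Fin.castSuccEmb) ⊆ K) :=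
          card_filter_supset_mono hS' k
      _ = (Fintype.card (Fin (n + 2)) - (w + 1)).choose (k - (w + 1)) := by
          rw [h𝒦, card_filter_supset _ _ (by rw [hcard']; omega), hcard']
      _ = (n + 1 - w).choose (k - 1 - w) := by
          rw [Fintype.card_fin]
          congr 1 <;> omega
  have h1 : (#𝒜₁ : ℝ) ≤ (Imax : ℝ) * (n - 1).choose (k - 3) +
      (Dmax : ℝ) * (n + 1 - w).choose (k - 1 - w) := by
    have h2 : #𝒜₁ ≤ #I * (n - 1).choose (k - 3) + #𝓓 * (n + 1 - w).choose (k - 1 - w) := by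
      calc #𝒜₁ ≤ #((I.biUnion fun j => 𝒦.filter fun K => T j ⊆ K) ∪
              (𝓓.biUnion fun P => 𝒦.filter fun K => S P ⊆ K)) := card_le_card hcover
        _ ≤ #(I.biUnion fun j => 𝒦.filter fun K => T j ⊆ K) +
              #(𝓓.biUnion fun P => 𝒦.filter fun K => S P ⊆ K) := card_union_le _ _
        _ ≤ ∑ j ∈ I, #(𝒦.filter fun K => T j ⊆ K) + ∑ P ∈ 𝓓, #(𝒦.filter fun K => S P ⊆ K) :=
            add_le_add card_biUnion_le card_biUnion_le
        _ ≤ ∑ _j ∈ I, (n - 1).choose (k - 3) + ∑ _P ∈ 𝓓, (n + 1 - w).choose (k - 1 - w) :=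
            add_le_add (sum_le_sum fun j _ => (hT j).le) (sum_le_sum fun P hP => hS P hP)
        _ = #I * (n - 1).choose (k - 3) + #𝓓 * (n + 1 - w).choose (k - 1 - w) := by
            simp [sum_const, smul_eq_mul]
    have h3 : (#𝒜₁ : ℝ) ≤ #I * (n - 1).choose (k - 3) + #𝓓 * (n + 1 - w).choose (k - 1 - w) := by
      exact_mod_cast h2
    refine h3.trans ?_
    have hI' : (#I : ℝ) ≤ (Imax : ℝ) := by exact_mod_cast hIcard
    have hD' : (#𝓓 : ℝ) ≤ (Dmax : ℝ) := by exact_mod_cast hDcard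
    have hC1 : (0 : ℝ) ≤ (n - 1).choose (k - 3) := Nat.cast_nonneg _
    have hC2 : (0 : ℝ) ≤ (n + 1 - w).choose (k - 1 - w) := Nat.cast_nonneg _
    nlinarith [mul_le_mul_of_nonneg_right hI' hC1, mul_le_mul_of_nonneg_right hD' hC2]
  -- conclude
  have htot : (n.choose (k - 2) : ℝ) = #𝒜₀ + #𝒜₁ := by
    rw [← hA_card, ← hsplit]; push_cast; ring
  linarith [h0, h1, Hii, htot]

end Finite

end

end Summit.PneNP.PneNP.Theorems.CliqueExtLowerBound.Negative
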